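import Mathlib
import HarnessLib
import Summits.HubbardSuperconductivity.HubbardSuperconductivity.Theorems.KLProgrammeCooperChannelRiccatiFlowDefs

/-!
# Route `KLProgramme` — DECOMP C2 «ChannelRiccati» in Lean, III: the scalar flow — monotonicity, gap propagation and
# the two-sided envelopes of an iterated one-loop Cooper step (DECOMP C2 (b), (c))

Cell gate-hubbard-kl, seat p3.  Files I–II (`KLProgrammeCooperChannelRiccatiFlow.lean`, `…Cascade.lean`) reduce one RG
step of a `D₄` block of the Cooper vertex to the SCALAR map of its form bottom / top, up to a remainder of known norm:
`x_{k+1} = cascadeStep b_k x_k + q_k` with `|q_k| ≤ ‖P_k‖` (or the same with `riccatiStep`).  This file is the scalar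
bookkeeping of the iteration (pure real analysis, no operators):

* monotonicity and contraction of the one-loop maps (`cascadeStep_mono`, `cascadeStep_le_self`, `cascadeStep_add_le`,
  `riccatiStep_mono`), the inverse-coupling form `1 / cascadeStep b x = 1 / x + b`, and GAP MONOTONICITY between two
  non-positive channel bottoms (`cascadeStep_gap_mono`, `riccatiStep_gap_mono`: DECOMP C2 (c), the gap between two
  attractive-or-zero blocks does not shrink under the step);
* the envelope algebra: `cascadeStep b (attractiveEnvelope A B) = attractiveEnvelope A (B + b)` (the explicit scalar
  solution `-A / (1 - A B)`), `attractiveEnvelope (A + d) B ≤ attractiveEnvelope A B - d` (drive injected LATER is amplified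
  LESS — so pretending all the drive was present at scale `0` is a valid lower envelope), and the repulsive analogues;
* discrete comparison principles (`cascade_comparison_lower/upper`) in the form a joint induction needs: the flow
  inequality at step `k` may assume the envelope at step `k`;
* the packaged envelopes of DECOMP C2 (b): `attractive_lower_envelope` — if `x₀ ≥ -A₀`, `x_{k+1} ≥ cascadeStep b_k x_k - d_k`
  and `(A₀ + Σ_{j<N} d_j)(Σ_{j<N} b_j) < 1` (no onset up to `N`), then `x_k ≥ -A_k / (1 - A_k B_k)` with `A_k = A₀ + Σ_{j<k} d_j`,
  `B_k = Σ_{j<k} b_j`; `upper_envelope_of_step_le` — `x_k ≤ x₀ + Σ_{j<k} e_j`; `repulsive_upper_envelope` —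
  `x_k ≤ A / (1 + A B_k) + Σ_{j<k} e_j`; and the gap propagation `gap_lower_bound` (C2 (c)).

In the programme (DECOMP App. E, E.4): `b_k ≥ 0` is the scale-`k` Cooper bubble mass on the Fermi curve (channel
independent), `-d_k ≤ q_k ≤ e_k` collects the channel-projected second-order source `⟨S_k⟩_Γ` (the Kohn–Luttinger drive,
concentrated at `|k| = O(1)`) and the summable remainders; the attractive envelope with `A_N = a_Γ U² (1 + O(U))` is the
bound `λ_h ∈ -a_± U² / (1 - a_± U² Σ b)` of C2 (b), valid up to `(1 - η)` of the onset.

References: HOME/DECOMP.md v6 §2 C2 (b), (c); App. E, E2 and Lemma E.4.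
-/

noncomputable section

namespace Summit.HubbardSuperconductivity.HubbardSuperconductivity.Theorems.CooperChannelRiccatiFlow

set_option linter.dupNamespace false -- summit = problem name (single-conjunct summit), D-0017

open Finset

/-! ## The one-loop maps: monotonicity, contraction, inverse-coupling form, gap monotonicity -/

/-- The cascade step is increasing on `{x | 1 + b x > 0}` (before the onset). -/
theorem cascadeStep_mono {b x y : ℝ} (hxy : x ≤ y) (hx : 0 < 1 + b * x) (hy : 0 < 1 + b * y) :
    cascadeStep b x ≤ cascadeStep b y := by
  rw [cascadeStep, cascadeStep, div_le_div_iff₀ hx hy]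
  nlinarith

/-- For `b ≥ 0` the cascade step does not increase the coupling: `cascadeStep b x ≤ x` (before the onset). -/
theorem cascadeStep_le_self {b x : ℝ} (hb : 0 ≤ b) (hx : 0 < 1 + b * x) : cascadeStep b x ≤ x := by
  rw [cascadeStep, div_le_iff₀ hx]
  nlinarith [sq_nonneg x]

/-- On the repulsive side the cascade step is `1`-Lipschitz from above: `cascadeStep b (x + e) ≤ cascadeStep b x + e` for
`b, x, e ≥ 0`. -/
theorem cascadeStep_add_le {b x e : ℝ} (hb : 0 ≤ b) (hx : 0 ≤ x) (he : 0 ≤ e) :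
    cascadeStep b (x + e) ≤ cascadeStep b x + e := by
  have h1 : 0 < 1 + b * x := by nlinarith [mul_nonneg hb hx]
  have h2 : 0 < 1 + b * (x + e) := by nlinarith [mul_nonneg hb (add_nonneg hx he)]
  have hden : 1 ≤ (1 + b * x) * (1 + b * (x + e)) := by
    nlinarith [mul_nonneg hb hx, mul_nonneg hb (add_nonneg hx he),
      mul_nonneg (mul_nonneg hb hx) (mul_nonneg hb (add_nonneg hx he))]
  have key : cascadeStep b (x + e) - cascadeStep b x = e / ((1 + b * x) * (1 + b * (x + e))) := by
    rw [cascadeStep, cascadeStep, div_sub_div _ _ h2.ne' h1.ne']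
    congr 1 <;> ring
  have : e / ((1 + b * x) * (1 + b * (x + e))) ≤ e := div_le_self he hden
  linarith

/-- **Inverse-coupling form of the cascade step:** `1 / cascadeStep b x = 1 / x + b` (`x ≠ 0`) — the
inverse coupling flows linearly. -/
theorem one_div_cascadeStep {b x : ℝ} (hx : x ≠ 0) : 1 / cascadeStep b x = 1 / x + b := by
  rw [cascadeStep]
  field_simp

/-- **Gap monotonicity for the cascade step (DECOMP C2 (c)).** For `b ≥ 0` and `x ≤ y ≤ 0` before the onset, the gap
does not shrink: `y - x ≤ cascadeStep b y - cascadeStep b x`. -/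
theorem cascadeStep_gap_mono {b x y : ℝ} (hb : 0 ≤ b) (hxy : x ≤ y) (hy : y ≤ 0) (hx : 0 < 1 + b * x) :
    y - x ≤ cascadeStep b y - cascadeStep b x := by
  have hy' : 0 < 1 + b * y := by nlinarith
  rw [cascadeStep, cascadeStep, div_sub_div _ _ hy'.ne' hx.ne', le_div_iff₀ (mul_pos hy' hx)]
  have hp1 : 1 + b * x ≤ 1 := by nlinarith
  have hq1 : 1 + b * y ≤ 1 := by nlinarith
  have hprod : (1 + b * y) * (1 + b * x) ≤ 1 := by nlinarith [mul_nonneg hy'.le hx.le]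
  nlinarith [mul_nonneg (sub_nonneg.mpr hxy) (sub_nonneg.mpr hprod)]

/-- The Riccati step is increasing below `1/(2b)`: `x ≤ y`, `b (x + y) ≤ 1 ⇒ riccatiStep b x ≤ riccatiStep b y`
(planner g2). -/
theorem riccatiStep_mono {b x y : ℝ} (hxy : x ≤ y) (hy : b * (x + y) ≤ 1) :
    riccatiStep b x ≤ riccatiStep b y := by
  unfold riccatiStep
  have h1 : 0 ≤ y - x := sub_nonneg.mpr hxy
  nlinarith [mul_nonneg h1 (sub_nonneg.mpr hy)]

/-- **Gap monotonicity for the Riccati step (DECOMP C2 (c), planner g2):** for `b ≥ 0`, `x ≤ y`, `x + y ≤ 0` the gap does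
not shrink: `y - x ≤ riccatiStep b y - riccatiStep b x`. -/
theorem riccatiStep_gap_mono {b x y : ℝ} (hb : 0 ≤ b) (hxy : x ≤ y) (hsum : x + y ≤ 0) :
    y - x ≤ riccatiStep b y - riccatiStep b x := by
  unfold riccatiStep
  have h1 : 0 ≤ y - x := sub_nonneg.mpr hxy
  have h2 : 0 ≤ -(b * (x + y)) := by nlinarith
  nlinarith [mul_nonneg h1 h2]

/-- On the attractive side the cascade step lies below its quadratic truncation:
`cascadeStep b x = x - b x² + b² x³ / (1 + b x) ≤ riccatiStep b x` for `x ≤ 0` before the onset.  Hence a lower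
envelope (subsolution) for the cascade flow is also one for the Riccati flow. -/
theorem cascadeStep_le_riccatiStep {b x : ℝ} (hx : x ≤ 0) (h : 0 < 1 + b * x) :
    cascadeStep b x ≤ riccatiStep b x := by
  rw [cascadeStep, riccatiStep, div_le_iff₀ h]
  have : 0 ≤ b ^ 2 * x ^ 2 * (-x) := mul_nonneg (by positivity) (neg_nonneg.mpr hx)
  nlinarith

/-! ## Envelope algebra -/

/-- `1 + b · attractiveEnvelope A B = (1 - A (B + b)) / (1 - A B)`. -/
theorem one_add_mul_attractiveEnvelope {A B b : ℝ} (h : 1 - A * B ≠ 0) :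
    1 + b * attractiveEnvelope A B = (1 - A * (B + b)) / (1 - A * B) := by
  rw [attractiveEnvelope]
  field_simp
  ring

/-- **The attractive envelope solves the cascade flow:** `cascadeStep b (attractiveEnvelope A B) = attractiveEnvelope A (B + b)`
(away from the onsets `A B = 1`, `A (B + b) = 1`). -/
theorem cascadeStep_attractiveEnvelope {A B b : ℝ} (h : 1 - A * B ≠ 0) (h' : 1 - A * (B + b) ≠ 0) :
    cascadeStep b (attractiveEnvelope A B) = attractiveEnvelope A (B + b) := by
  rw [cascadeStep, one_add_mul_attractiveEnvelope h, attractiveEnvelope, attractiveEnvelope]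
  field_simp

/-- **Later drive is amplified less:** for `A, d, B ≥ 0` with `(A + d) B < 1`,
`attractiveEnvelope (A + d) B ≤ attractiveEnvelope A B - d`. -/
theorem attractiveEnvelope_add_le {A d B : ℝ} (hA : 0 ≤ A) (hd : 0 ≤ d) (hB : 0 ≤ B) (h : (A + d) * B < 1) :
    attractiveEnvelope (A + d) B ≤ attractiveEnvelope A B - d := by
  have h1 : 0 < 1 - (A + d) * B := by linarith
  have h2 : 0 < 1 - A * B := by nlinarith
  rw [attractiveEnvelope, attractiveEnvelope, div_le_iff₀ h1]
  have : (-A / (1 - A * B) - d) * (1 - (A + d) * B) = -A - d + d * (A + d) * B + A * (d * B) / (1 - A * B) := by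
    field_simp
    ring
  rw [this]
  have hlast : A * (d * B) / (1 - A * B) ≥ 0 := by positivity
  nlinarith [mul_nonneg (mul_nonneg hd (add_nonneg hA hd)) hB]

/-- The attractive envelope is non-positive before the onset (`A ≥ 0`, `A B < 1`). -/
theorem attractiveEnvelope_nonpos {A B : ℝ} (hA : 0 ≤ A) (h : A * B < 1) : attractiveEnvelope A B ≤ 0 := by
  rw [attractiveEnvelope]
  exact div_nonpos_of_nonpos_of_nonneg (neg_nonpos.mpr hA) (by linarith)

/-- The attractive envelope is decreasing in the bubble mass (`A ≥ 0`, before the onset). -/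
theorem attractiveEnvelope_anti_right {A B B' : ℝ} (hA : 0 ≤ A) (hBB' : B ≤ B') (h : A * B' < 1) :
    attractiveEnvelope A B' ≤ attractiveEnvelope A B := by
  have h1 : 0 < 1 - A * B' := by linarith
  have h2 : 0 < 1 - A * B := by nlinarith
  rw [attractiveEnvelope, attractiveEnvelope, div_le_div_iff₀ h1 h2]
  nlinarith [mul_nonneg hA (sub_nonneg.mpr hBB')]

/-- **The repulsive envelope solves the cascade flow:** `cascadeStep b (repulsiveEnvelope A B) = repulsiveEnvelope A (B + b)`. -/
theorem cascadeStep_repulsiveEnvelope {A B b : ℝ} (h : 1 + A * B ≠ 0) (h' : 1 + A * (B + b) ≠ 0) :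
    cascadeStep b (repulsiveEnvelope A B) = repulsiveEnvelope A (B + b) := by
  have e : 1 + b * repulsiveEnvelope A B = (1 + A * (B + b)) / (1 + A * B) := by
    rw [repulsiveEnvelope]
    field_simp
    ring
  rw [cascadeStep, e, repulsiveEnvelope, repulsiveEnvelope]
  field_simp

/-- The repulsive envelope is nonnegative (`A, B ≥ 0`). -/
theorem repulsiveEnvelope_nonneg {A B : ℝ} (hA : 0 ≤ A) (hB : 0 ≤ B) : 0 ≤ repulsiveEnvelope A B := by
  rw [repulsiveEnvelope]
  positivity

/-! ## Discrete comparison principles -/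

/-- **Comparison principle, lower envelope.**  Let `b_k ≥ 0`.  If `ℓ` is a SUBSOLUTION of the perturbed cascade flow
(`ℓ_{k+1} ≤ cascadeStep b_k ℓ_k + q_k`) staying before the onset (`1 + b_k ℓ_k > 0`), `ℓ_0 ≤ x_0`, and `x` is a
supersolution WHENEVER it is above the envelope (`ℓ_k ≤ x_k ⇒ cascadeStep b_k x_k + q_k ≤ x_{k+1}` — the form a joint
induction supplies), then `ℓ_k ≤ x_k` for all `k ≤ N`. -/
theorem cascade_comparison_lower {b q x ℓ : ℕ → ℝ} {N : ℕ} (hb : ∀ k, 0 ≤ b k) (h0 : ℓ 0 ≤ x 0)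
    (hℓpos : ∀ k < N, 0 < 1 + b k * ℓ k) (hℓstep : ∀ k < N, ℓ (k + 1) ≤ cascadeStep (b k) (ℓ k) + q k)
    (hx : ∀ k < N, ℓ k ≤ x k → cascadeStep (b k) (x k) + q k ≤ x (k + 1)) :
    ∀ k ≤ N, ℓ k ≤ x k := by
  intro k
  induction k with
  | zero => exact fun _ => h0
  | succ k ih =>
    intro hk
    have hk' : k < N := Nat.lt_of_succ_le hk
    have hle : ℓ k ≤ x k := ih hk'.le
    have hxpos : 0 < 1 + b k * x k := by nlinarith [hℓpos k hk', hb k]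
    calc ℓ (k + 1) ≤ cascadeStep (b k) (ℓ k) + q k := hℓstep k hk'
      _ ≤ cascadeStep (b k) (x k) + q k := by gcongr ?_ + _; exact cascadeStep_mono hle (hℓpos k hk') hxpos
      _ ≤ x (k + 1) := hx k hk' hle

/-- **Comparison principle, upper envelope.**  Let `b_k ≥ 0` and let `x` stay before the onset (`1 + b_k x_k > 0`, e.g. by a
lower envelope).  If `μ` is a SUPERSOLUTION (`cascadeStep b_k μ_k + q_k ≤ μ_{k+1}`), `x_0 ≤ μ_0`, and `x` is a subsolution
whenever it is below the envelope (`x_k ≤ μ_k ⇒ x_{k+1} ≤ cascadeStep b_k x_k + q_k`), then `x_k ≤ μ_k` for all `k ≤ N`. -/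
theorem cascade_comparison_upper {b q x μ : ℕ → ℝ} {N : ℕ} (hb : ∀ k, 0 ≤ b k) (h0 : x 0 ≤ μ 0)
    (hxpos : ∀ k < N, 0 < 1 + b k * x k) (hμstep : ∀ k < N, cascadeStep (b k) (μ k) + q k ≤ μ (k + 1))
    (hx : ∀ k < N, x k ≤ μ k → x (k + 1) ≤ cascadeStep (b k) (x k) + q k) :
    ∀ k ≤ N, x k ≤ μ k := by
  intro k
  induction k with
  | zero => exact fun _ => h0
  | succ k ih =>
    intro hk
    have hk' : k < N := Nat.lt_of_succ_le hk
    have hle : x k ≤ μ k := ih hk'.le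
    have hμpos : 0 < 1 + b k * μ k := by nlinarith [hxpos k hk', hb k]
    calc x (k + 1) ≤ cascadeStep (b k) (x k) + q k := hx k hk' hle
      _ ≤ cascadeStep (b k) (μ k) + q k := by gcongr ?_ + _; exact cascadeStep_mono hle (hxpos k hk') hμpos
      _ ≤ μ (k + 1) := hμstep k hk'

/-! ## The packaged envelopes (DECOMP C2 (b)) and the gap propagation (C2 (c)) -/

/-- **Attractive lower envelope (DECOMP C2 (b), lower side).**  Let `b_k, d_k ≥ 0`, `A₀ ≥ 0`, `x₀ ≥ -A₀`, and suppose no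
onset is reached up to step `N` even if all the drive were injected at once: `(A₀ + Σ_{j<N} d_j) · (Σ_{j<N} b_j) < 1`.  If the
flow satisfies `x_{k+1} ≥ cascadeStep b_k x_k - d_k` whenever `x_k` is above the envelope, then for all `k ≤ N`
`x_k ≥ attractiveEnvelope (A₀ + Σ_{j<k} d_j) (Σ_{j<k} b_j) = -A_k / (1 - A_k B_k)`. -/
theorem attractive_lower_envelope {b d x : ℕ → ℝ} {A₀ : ℝ} {N : ℕ} (hb : ∀ k, 0 ≤ b k) (hd : ∀ k, 0 ≤ d k)
    (hA₀ : 0 ≤ A₀) (hx0 : -A₀ ≤ x 0)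
    (honset : (A₀ + ∑ j ∈ range N, d j) * (∑ j ∈ range N, b j) < 1)
    (hx : ∀ k < N, attractiveEnvelope (A₀ + ∑ j ∈ range k, d j) (∑ j ∈ range k, b j) ≤ x k →
      cascadeStep (b k) (x k) - d k ≤ x (k + 1)) :
    ∀ k ≤ N, attractiveEnvelope (A₀ + ∑ j ∈ range k, d j) (∑ j ∈ range k, b j) ≤ x k := by
  -- notation
  set A : ℕ → ℝ := fun k => A₀ + ∑ j ∈ range k, d j with hA_def
  set B : ℕ → ℝ := fun k => ∑ j ∈ range k, b j with hB_def
  have hA_nonneg : ∀ k, 0 ≤ A k := fun k => add_nonneg hA₀ (sum_nonneg fun j _ => hd j)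
  have hB_nonneg : ∀ k, 0 ≤ B k := fun k => sum_nonneg fun j _ => hb j
  have hA_mono : ∀ {k l}, k ≤ l → A k ≤ A l := fun {k l} hkl => by
    show A₀ + ∑ j ∈ range k, d j ≤ A₀ + ∑ j ∈ range l, d j
    exact add_le_add_right (sum_le_sum_of_subset_of_nonneg (range_mono hkl) fun j _ _ => hd j) _
  have hB_mono : ∀ {k l}, k ≤ l → B k ≤ B l := fun {k l} hkl =>
    sum_le_sum_of_subset_of_nonneg (range_mono hkl) fun j _ _ => hb j
  have hA_succ : ∀ k, A (k + 1) = A k + d k := fun k => by simp only [hA_def, sum_range_succ]; ring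
  have hB_succ : ∀ k, B (k + 1) = B k + b k := fun k => by simp only [hB_def, sum_range_succ]
  -- before the onset, uniformly
  have hAB : ∀ {k l}, k ≤ N → l ≤ N → A k * B l < 1 := fun {k l} hk hl =>
    lt_of_le_of_lt (mul_le_mul (hA_mono hk) (hB_mono hl) (hB_nonneg l) (hA_nonneg N)) honset
  -- apply the comparison principle with ℓ k = attractiveEnvelope (A k) (B k), q k = - d k
  have key := cascade_comparison_lower (ℓ := fun k => attractiveEnvelope (A k) (B k)) (q := fun k => -d k)
    (x := x) (N := N) hb ?_ ?_ ?_ ?_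
  · intro k hk
    exact key k hk
  · show attractiveEnvelope (A 0) (B 0) ≤ x 0
    have : attractiveEnvelope (A 0) (B 0) = -A₀ := by simp [hA_def, hB_def, attractiveEnvelope]
    rw [this]
    exact hx0
  · intro k hk
    show 0 < 1 + b k * attractiveEnvelope (A k) (B k)
    have h1 : 0 < 1 - A k * B k := by linarith [hAB hk.le hk.le]
    have h2 : 0 < 1 - A k * (B k + b k) := by rw [← hB_succ]; linarith [hAB hk.le (Nat.succ_le_of_lt hk)]
    rw [one_add_mul_attractiveEnvelope h1.ne']
    exact div_pos h2 h1
  · intro k hk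
    show attractiveEnvelope (A (k + 1)) (B (k + 1)) ≤ cascadeStep (b k) (attractiveEnvelope (A k) (B k)) + -d k
    have h1 : 0 < 1 - A k * B k := by linarith [hAB hk.le hk.le]
    have h2 : A k * B (k + 1) < 1 := hAB hk.le (Nat.succ_le_of_lt hk)
    have h3 : (A k + d k) * B (k + 1) < 1 := by rw [← hA_succ]; exact hAB (Nat.succ_le_of_lt hk) (Nat.succ_le_of_lt hk)
    rw [hB_succ] at h2 h3
    rw [cascadeStep_attractiveEnvelope h1.ne' (by linarith), hA_succ, hB_succ, ← sub_eq_add_neg]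
    exact attractiveEnvelope_add_le (hA_nonneg k) (hd k) (by rw [← hB_succ]; exact hB_nonneg _) h3
  · intro k hk hle
    have := hx k hk hle
    linarith

/-- **Trivial upper envelope:** for `b_k ≥ 0` and a flow staying before the onset with `x_{k+1} ≤ cascadeStep b_k x_k + e_k`,
`x_k ≤ x_0 + Σ_{j<k} e_j` (the step never increases the coupling).  This is the `V_j^Γ ≤ 0 + C U²` half of DECOMP App. E,
Lemma E.4 for the attractive blocks. -/
theorem upper_envelope_of_step_le {b e x : ℕ → ℝ} {N : ℕ} (hb : ∀ k, 0 ≤ b k)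
    (hxpos : ∀ k < N, 0 < 1 + b k * x k) (hx : ∀ k < N, x (k + 1) ≤ cascadeStep (b k) (x k) + e k) :
    ∀ k ≤ N, x k ≤ x 0 + ∑ j ∈ range k, e j := by
  intro k
  induction k with
  | zero => intro; simp
  | succ k ih =>
    intro hk
    have hk' : k < N := Nat.lt_of_succ_le hk
    rw [sum_range_succ]
    linarith [ih hk'.le, hx k hk', cascadeStep_le_self (hb k) (hxpos k hk')]

/-- **Repulsive upper envelope:** for `b_k, e_k ≥ 0`, `0 ≤ x_0 ≤ A`... more precisely `x_0 ≤ A` with `A ≥ 0`, a flow staying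
before the onset with `x_{k+1} ≤ cascadeStep b_k x_k + e_k` satisfies `x_k ≤ A / (1 + A Σ_{j<k} b_j) + Σ_{j<k} e_j`
(DECOMP App. E, Lemma E.4: the repulsive `A1g` block decays like `1 / Σ b`, up to the summable remainders). -/
theorem repulsive_upper_envelope {b e x : ℕ → ℝ} {A : ℝ} {N : ℕ} (hb : ∀ k, 0 ≤ b k) (he : ∀ k, 0 ≤ e k)
    (hA : 0 ≤ A) (hx0 : x 0 ≤ A) (hxpos : ∀ k < N, 0 < 1 + b k * x k)
    (hx : ∀ k < N, x (k + 1) ≤ cascadeStep (b k) (x k) + e k) :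
    ∀ k ≤ N, x k ≤ repulsiveEnvelope A (∑ j ∈ range k, b j) + ∑ j ∈ range k, e j := by
  set B : ℕ → ℝ := fun k => ∑ j ∈ range k, b j with hB_def
  set Es : ℕ → ℝ := fun k => ∑ j ∈ range k, e j with hE_def
  have hB_nonneg : ∀ k, 0 ≤ B k := fun k => sum_nonneg fun j _ => hb j
  have hE_nonneg : ∀ k, 0 ≤ Es k := fun k => sum_nonneg fun j _ => he j
  have hB_succ : ∀ k, B (k + 1) = B k + b k := fun k => by simp only [hB_def, sum_range_succ]
  have hE_succ : ∀ k, Es (k + 1) = Es k + e k := fun k => by simp only [hE_def, sum_range_succ]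
  have key := cascade_comparison_upper (μ := fun k => repulsiveEnvelope A (B k) + Es k) (q := e) (x := x) (N := N)
    hb ?_ hxpos ?_ (fun k hk _ => hx k hk)
  · intro k hk
    exact key k hk
  · show x 0 ≤ repulsiveEnvelope A (B 0) + Es 0
    simp [hB_def, hE_def, repulsiveEnvelope]
    exact hx0
  · intro k hk
    show cascadeStep (b k) (repulsiveEnvelope A (B k) + Es k) + e k ≤ repulsiveEnvelope A (B (k + 1)) + Es (k + 1)
    have hψ := repulsiveEnvelope_nonneg hA (hB_nonneg k)
    have h1 : (1 : ℝ) + A * B k ≠ 0 := by nlinarith [mul_nonneg hA (hB_nonneg k)]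
    have h2 : (1 : ℝ) + A * (B k + b k) ≠ 0 := by nlinarith [mul_nonneg hA (hB_nonneg k), mul_nonneg hA (hb k)]
    calc cascadeStep (b k) (repulsiveEnvelope A (B k) + Es k) + e k
        ≤ (cascadeStep (b k) (repulsiveEnvelope A (B k)) + Es k) + e k := by
          gcongr ?_ + _
          exact cascadeStep_add_le (hb k) hψ (hE_nonneg k)
      _ = repulsiveEnvelope A (B (k + 1)) + Es (k + 1) := by
          rw [cascadeStep_repulsiveEnvelope h1 h2, hB_succ, hE_succ]
          ring

/-- **Gap propagation (DECOMP C2 (c)).**  Two channel bottoms driven by the same bubble masses `b_k ≥ 0`: `x` (the leading,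
more attractive one, e.g. `B1g`) with `x_{k+1} ≤ cascadeStep b_k x_k + qx_k`, and `y` with `y_{k+1} ≥ cascadeStep b_k y_k + qy_k`,
`y_k ≤ 0`, `x` before the onset.  If the accumulated source gap `G_k = (y_0 - x_0) + Σ_{j<k} (qy_j - qx_j)` stays `≥ 0`, then
it bounds the gap from below: `G_k ≤ y_k - x_k` for all `k ≤ N` (gaps between non-positive bottoms do not shrink under the step). -/
theorem gap_lower_bound {b qx qy x y : ℕ → ℝ} {N : ℕ} (hb : ∀ k, 0 ≤ b k)
    (hxpos : ∀ k < N, 0 < 1 + b k * x k) (hy : ∀ k < N, y k ≤ 0)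
    (hxstep : ∀ k < N, x (k + 1) ≤ cascadeStep (b k) (x k) + qx k)
    (hystep : ∀ k < N, cascadeStep (b k) (y k) + qy k ≤ y (k + 1))
    (hG : ∀ k ≤ N, 0 ≤ (y 0 - x 0) + ∑ j ∈ range k, (qy j - qx j)) :
    ∀ k ≤ N, (y 0 - x 0) + ∑ j ∈ range k, (qy j - qx j) ≤ y k - x k := by
  intro k
  induction k with
  | zero => intro; simp
  | succ k ih =>
    intro hk
    have hk' : k < N := Nat.lt_of_succ_le hk
    have hgap : (y 0 - x 0) + ∑ j ∈ range k, (qy j - qx j) ≤ y k - x k := ih hk'.le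
    have hxy : x k ≤ y k := by linarith [hG k hk'.le]
    have hmono := cascadeStep_gap_mono (hb k) hxy (hy k hk') (hxpos k hk')
    rw [sum_range_succ]
    linarith [hxstep k hk', hystep k hk']

end Summit.HubbardSuperconductivity.HubbardSuperconductivity.Theorems.CooperChannelRiccatiFlow

end
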